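import Summits.AtomisticToContinuum.Crystallization.Theorems.FreeSplittingCertificatesStrictSplittingRuleP1ReadSummable
import Summits.AtomisticToContinuum.Crystallization.Theorems.FreeSplittingCertificatesStrictSplittingRuleP1DemandBareF

/-!
# `StrictSplittingRule` (stmt-AtomisticToContinuum-12560): SUMMABILITY / INTEGRABILITY of the bare-demand bookkeeping families for the far-ledger field (P1 interpolant object, part 41)

Route `FreeSplittingCertificates`, crux r3 `StrictSplittingRule` (H12⋆ = `stub_coreJointCoercive`), unit b2b-freesplit-B gen 32.
VALUE = the analytic side conditions of the demand-side transfer lemmas, discharged for the field the assembly uses (HOME CERT §27, §29 (2);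
FAR-LEMMA-SPEC §17 (e), §18): the global bare-demand transfers `tsum_p1SiteBare_le` (part 27), `tsum_p1SiteBare_le_fun` (part 29) and the
circumradius form `tsum_p1SiteBare_le_rad` (part 31) were proved for arbitrary lattice values `V` MODULO (i) integrability of the continuum bare
density `q_{W(y)}(ṽ(y))` of the interpolant and (ii) summability of the defect family (edge-energy form resp. circumradius form).  For the far-ledger
lattice field `V = p1DispSite a h U b₀ A` of a finitely supported `U` (so `ṽ = p1Field V = p1Disp`, part 30) both hold under hypotheses on the WEIGHT
alone:
* **`exists_bound_p1CellEdgeEnergy_p1DispSite`** — the per-cell edge energies `½Σ_{m,m'}|V_m − V_{m'}|²` are bounded uniformly over the cells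
  (every vertex-offset difference is one of finitely many lattice vectors; part 40's bounded bond readouts);
* **`summable_edgeDefect_p1DispSite`** / **`summable_radDefect_p1DispSite`** — the defect families `(∫_T ω)·EdgeEnergy_T` and `(∫_T ω)·ρ_T·|G_T|²_F`
  are summable for every nonnegative integrable `ω` and bounded `ρ` (cells decomposition `hasSum_setIntegral_p1RealCell` + the bounds of part 40);
* **`integrable_p1Quad3_p1Disp`** — `y ↦ q_{W(y)}(ṽ(y))` is integrable whenever `0 ≤ q_{W(y)}(u) ≤ ω(y)|u|²` with `W` continuous and
  `ω(y)(1+‖y‖)²` integrable (the field is Lipschitz, hence of linear growth; in the ledger `ω = const·χ²|y|⁻⁸`, so `ω(1+‖y‖)² ~ |y|⁻⁶`);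
* **`tsum_p1SiteBare_le_fun_p1DispSite`**, **`tsum_p1SiteBare_le_rad_p1DispSite`** — parts 29/31 for the far-ledger field with `hint`/`hdef` DISCHARGED:
  the matched lattice bare form is bounded by the continuum bare integral of `p1Disp` plus the defect, under weight hypotheses only.
NOT a proof of H12⋆, NOT summit progress.  [folklore]
-/

noncomputable section

open Set Function Metric MeasureTheory Filter Topology
open scoped BigOperators NNReal ENNReal

namespace Summit.AtomisticToContinuum.Crystallization.Theorems.StrictSplittingRuleBirth

open Literature.MathematicalPhysics.StatisticalMechanics
open Summit.AtomisticToContinuum.Crystallization.Theorems.PalmUnimodularRigidity.LayeredLawsSelectHcp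

/-! ## Edge energies of the far-ledger field are bounded; the defect families are summable -/

/-- **Bounded edge energies**: for `V = p1DispSite a h U b₀ A` with `U` finitely supported, `p1CellEdgeEnergy V T ≤ B` uniformly in the cell `T`.
NOT a proof of H12⋆, NOT summit progress. -/
theorem exists_bound_p1CellEdgeEnergy_p1DispSite {a h : ℝ} (ha : 0 < a) (hh : 0 < h) (U : ℤ × ℤ × ℤ → (Fin 3 → ℝ))
    (hU : (support U).Finite) (b₀ : Fin 3 → ℝ) (A : Fin 3 → Fin 3 → ℝ) :
    ∃ B : ℝ, ∀ T, p1CellEdgeEnergy (fun n k => p1DispSite a h U b₀ A n k) T ≤ B := by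
  classical
  set V : ℤ × ℤ × ℤ → (Fin 3 → ℝ) := fun n k => p1DispSite a h U b₀ A n k with hVdef
  have hb : ∀ d : ℤ × ℤ × ℤ, ∃ B : ℝ, ∀ q, fpSq (fun k => V (q + d) k - V q k) ≤ B := fun d =>
    exists_bound_readout_p1DispSite ha hh U hU b₀ A d
  choose Bf hBf using hb
  have hBf0 : ∀ d, 0 ≤ Bf d := fun d => (fpSq_nonneg _).trans (hBf d 0)
  -- the finitely many vertex-offset differences
  set D : Finset (ℤ × ℤ × ℤ) := Finset.univ.image
    fun x : Bool × Fin 6 × Fin 4 × Fin 4 => p1VertOff x.1 x.2.1 x.2.2.1 - p1VertOff x.1 x.2.1 x.2.2.2 with hD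
  set M : ℝ := ∑ d ∈ D, Bf d with hM
  have hkey : ∀ q d, d ∈ D → fpSq (fun k => V (q + d) k - V q k) ≤ M := fun q d hd =>
    (hBf d q).trans (Finset.single_le_sum (fun d _ => hBf0 d) hd)
  refine ⟨1 / 2 * (16 * M), fun T => ?_⟩
  have hterm : ∀ m m' : Fin 4,
      (p1CellVals V T m 0 - p1CellVals V T m' 0) ^ 2 + (p1CellVals V T m 1 - p1CellVals V T m' 1) ^ 2 +
        (p1CellVals V T m 2 - p1CellVals V T m' 2) ^ 2 ≤ M := by
    intro m m'
    have hd : p1VertOff (p1Par T.1) T.2 m - p1VertOff (p1Par T.1) T.2 m' ∈ D :=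
      Finset.mem_image.2 ⟨(p1Par T.1, T.2, m, m'), Finset.mem_univ _, rfl⟩
    have e : T.1 + p1VertOff (p1Par T.1) T.2 m' + (p1VertOff (p1Par T.1) T.2 m - p1VertOff (p1Par T.1) T.2 m') =
        T.1 + p1VertOff (p1Par T.1) T.2 m := by abel
    have := hkey (T.1 + p1VertOff (p1Par T.1) T.2 m') _ hd
    rw [e] at this
    exact this
  calc p1CellEdgeEnergy V T
      = 1 / 2 * ∑ m : Fin 4, ∑ m' : Fin 4, ((p1CellVals V T m 0 - p1CellVals V T m' 0) ^ 2 +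
          (p1CellVals V T m 1 - p1CellVals V T m' 1) ^ 2 + (p1CellVals V T m 2 - p1CellVals V T m' 2) ^ 2) := rfl
    _ ≤ 1 / 2 * ∑ _m : Fin 4, ∑ _m' : Fin 4, M :=
        mul_le_mul_of_nonneg_left (Finset.sum_le_sum fun m _ => Finset.sum_le_sum fun m' _ => hterm m m') (by norm_num)
    _ = 1 / 2 * (16 * M) := by simp; ring

/-- The cell integrals of a nonnegative integrable weight form a summable family (cells decomposition). -/
theorem summable_setIntegral_p1RealCell {a h : ℝ} (ha : a ≠ 0) (hh : h ≠ 0) {ω : (Fin 3 → ℝ) → ℝ} (hωi : Integrable ω) :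
    Summable fun i => ∫ y in p1RealCell a h i, ω y :=
  (hasSum_setIntegral_p1RealCell ha hh hωi).summable

/-- **Summability of the edge-energy defect family** for the far-ledger field: `T ↦ (∫_T ω)·EdgeEnergy_T(V)` is summable for every nonnegative
integrable `ω`.  NOT a proof of H12⋆, NOT summit progress. -/
theorem summable_edgeDefect_p1DispSite {a h : ℝ} (ha : 0 < a) (hh : 0 < h) (U : ℤ × ℤ × ℤ → (Fin 3 → ℝ))
    (hU : (support U).Finite) (b₀ : Fin 3 → ℝ) (A : Fin 3 → Fin 3 → ℝ) {ω : (Fin 3 → ℝ) → ℝ} (hω0 : ∀ y, 0 ≤ ω y)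
    (hωi : Integrable ω) :
    Summable fun i => (∫ y in p1RealCell a h i, ω y) * p1CellEdgeEnergy (fun n k => p1DispSite a h U b₀ A n k) i := by
  obtain ⟨B, hB⟩ := exists_bound_p1CellEdgeEnergy_p1DispSite ha hh U hU b₀ A
  have hI0 : ∀ i, 0 ≤ ∫ y in p1RealCell a h i, ω y := fun i => setIntegral_nonneg (isClosed_p1RealCell a h i).measurableSet fun y _ => hω0 y
  refine Summable.of_nonneg_of_le (fun i => mul_nonneg (hI0 i) (p1CellEdgeEnergy_nonneg _ i)) (fun i => ?_)
    ((summable_setIntegral_p1RealCell ha.ne' hh.ne' hωi).mul_right B)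
  exact mul_le_mul_of_nonneg_left (hB i) (hI0 i)

/-- **Summability of the circumradius defect family** for the far-ledger field: `T ↦ (∫_T ω)·(ρ_T·|G_T(V)|²_F)` is summable for every nonnegative
integrable `ω` and bounded radii `|ρ_T| ≤ ρ₀`.  NOT a proof of H12⋆, NOT summit progress. -/
theorem summable_radDefect_p1DispSite {a h : ℝ} (ha : 0 < a) (hh : 0 < h) (U : ℤ × ℤ × ℤ → (Fin 3 → ℝ))
    (hU : (support U).Finite) (b₀ : Fin 3 → ℝ) (A : Fin 3 → Fin 3 → ℝ) {ω : (Fin 3 → ℝ) → ℝ} (hω0 : ∀ y, 0 ≤ ω y)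
    (hωi : Integrable ω) (ρ : (ℤ × ℤ × ℤ) × Fin 6 → ℝ) {ρ₀ : ℝ} (hρ : ∀ i, |ρ i| ≤ ρ₀) :
    Summable fun i => (∫ y in p1RealCell a h i, ω y) * (ρ i * fpFrob (p1CellGrad a h (fun n k => p1DispSite a h U b₀ A n k) i)) := by
  obtain ⟨B, hB⟩ := exists_bound_fpFrob_p1CellGrad_p1DispSite ha hh U hU b₀ A
  have hI0 : ∀ i, 0 ≤ ∫ y in p1RealCell a h i, ω y := fun i => setIntegral_nonneg (isClosed_p1RealCell a h i).measurableSet fun y _ => hω0 y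
  have hF0 : ∀ i, 0 ≤ fpFrob (p1CellGrad a h (fun n k => p1DispSite a h U b₀ A n k) i) := fun i => by unfold fpFrob; positivity
  refine Summable.of_norm_bounded ((summable_setIntegral_p1RealCell ha.ne' hh.ne' hωi).mul_right (ρ₀ * B)) fun i => ?_
  rw [Real.norm_eq_abs, abs_mul, abs_of_nonneg (hI0 i), abs_mul, abs_of_nonneg (hF0 i)]
  exact mul_le_mul_of_nonneg_left (mul_le_mul (hρ i) (hB i) (hF0 i) ((abs_nonneg _).trans (hρ i))) (hI0 i)

/-- A pointwise majorant weight of a positive semidefinite `3×3` form is nonnegative (test vector `e₀`). -/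
theorem p1Quad3_majorant_nonneg {W : Fin 3 → Fin 3 → ℝ} {ω : ℝ} (hW0 : ∀ u : Fin 3 → ℝ, 0 ≤ p1Quad3 W u)
    (hω : ∀ u : Fin 3 → ℝ, p1Quad3 W u ≤ ω * (u 0 ^ 2 + u 1 ^ 2 + u 2 ^ 2)) : 0 ≤ ω := by
  have h1 := hW0 (fpE 0)
  have h2 := hω (fpE 0)
  have h3 : (fpE 0) 0 ^ 2 + (fpE 0) 1 ^ 2 + (fpE 0) 2 ^ 2 = 1 := by simp [fpE]
  rw [h3, mul_one] at h2
  exact h1.trans h2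

/-! ## Integrability of the continuum bare density of the far-ledger field -/

/-- **Linear growth of the far-ledger field**: `|v(y)_k| ≤ M(1 + ‖y‖)` for every component (Lipschitz, part 15). -/
theorem exists_linearGrowth_p1Disp {a h : ℝ} (ha : 0 < a) (hh : 0 < h) (U : ℤ × ℤ × ℤ → (Fin 3 → ℝ)) (hU : (support U).Finite)
    (b₀ : Fin 3 → ℝ) (A : Fin 3 → Fin 3 → ℝ) :
    ∃ M : ℝ, 0 ≤ M ∧ ∀ y k, |p1Disp a h U b₀ A y k| ≤ M * (1 + ‖y‖) := by
  obtain ⟨K, hK⟩ := exists_lipschitzWith_p1Disp ha.ne' hh.ne' U hU b₀ A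
  refine ⟨max ‖p1Disp a h U b₀ A 0‖ K, (norm_nonneg _).trans (le_max_left _ _), fun y k => ?_⟩
  have h1 : dist (p1Disp a h U b₀ A y) (p1Disp a h U b₀ A 0) ≤ K * dist y 0 := hK.dist_le_mul y 0
  rw [dist_eq_norm, dist_zero_right] at h1
  have h2 : ‖p1Disp a h U b₀ A y‖ ≤ ‖p1Disp a h U b₀ A 0‖ + K * ‖y‖ := by
    linarith [norm_sub_norm_le (p1Disp a h U b₀ A y) (p1Disp a h U b₀ A 0)]
  calc |p1Disp a h U b₀ A y k| = ‖p1Disp a h U b₀ A y k‖ := (Real.norm_eq_abs _).symm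
    _ ≤ ‖p1Disp a h U b₀ A y‖ := norm_le_pi_norm _ k
    _ ≤ ‖p1Disp a h U b₀ A 0‖ + K * ‖y‖ := h2
    _ ≤ max ‖p1Disp a h U b₀ A 0‖ K + max ‖p1Disp a h U b₀ A 0‖ K * ‖y‖ :=
        add_le_add (le_max_left _ _) (mul_le_mul_of_nonneg_right (le_max_right _ _) (norm_nonneg _))
    _ = max ‖p1Disp a h U b₀ A 0‖ K * (1 + ‖y‖) := by ring

/-- **Integrability of the continuum bare density of the far-ledger field**: if `0 ≤ q_{W(y)}(u) ≤ ω(y)|u|²` with `W` continuous and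
`ω(y)(1+‖y‖)²` integrable, then `y ↦ q_{W(y)}(v(y))` is integrable for `v = p1Disp a h U b₀ A` (`U` finitely supported).
NOT a proof of H12⋆, NOT summit progress. -/
theorem integrable_p1Quad3_p1Disp {a h : ℝ} (ha : 0 < a) (hh : 0 < h) (W : (Fin 3 → ℝ) → Fin 3 → Fin 3 → ℝ)
    (hWc : ∀ k l, Continuous fun x => W x k l) (hW0 : ∀ y : Fin 3 → ℝ, ∀ u : Fin 3 → ℝ, 0 ≤ p1Quad3 (W y) u)
    {ω : (Fin 3 → ℝ) → ℝ} (hω : ∀ y : Fin 3 → ℝ, ∀ u : Fin 3 → ℝ, p1Quad3 (W y) u ≤ ω y * (u 0 ^ 2 + u 1 ^ 2 + u 2 ^ 2))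
    (hωi : Integrable fun y => ω y * (1 + ‖y‖) ^ 2)
    (U : ℤ × ℤ × ℤ → (Fin 3 → ℝ)) (hU : (support U).Finite) (b₀ : Fin 3 → ℝ) (A : Fin 3 → Fin 3 → ℝ) :
    Integrable fun y => p1Quad3 (W y) (p1Disp a h U b₀ A y) := by
  obtain ⟨M, hM0, hM⟩ := exists_linearGrowth_p1Disp ha hh U hU b₀ A
  have hv := continuous_p1Disp a h U b₀ A
  have hc : Continuous fun y => p1Quad3 (W y) (p1Disp a h U b₀ A y) := by
    unfold p1Quad3
    refine continuous_finsetSum _ fun k _ => continuous_finsetSum _ fun l _ => ?_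
    exact ((hWc k l).mul ((continuous_apply k).comp hv)).mul ((continuous_apply l).comp hv)
  refine Integrable.mono' (hωi.const_mul (3 * M ^ 2)) hc.aestronglyMeasurable (Eventually.of_forall fun y => ?_)
  rw [Real.norm_eq_abs, abs_of_nonneg (hW0 y _)]
  have hsq : ∀ k, (p1Disp a h U b₀ A y k) ^ 2 ≤ (M * (1 + ‖y‖)) ^ 2 := fun k =>
    sq_le_sq' (abs_le.1 (hM y k)).1 (abs_le.1 (hM y k)).2
  have hω0 : 0 ≤ ω y := p1Quad3_majorant_nonneg (hW0 y) (hω y)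
  calc p1Quad3 (W y) (p1Disp a h U b₀ A y)
      ≤ ω y * ((p1Disp a h U b₀ A y 0) ^ 2 + (p1Disp a h U b₀ A y 1) ^ 2 + (p1Disp a h U b₀ A y 2) ^ 2) := hω y _
    _ ≤ ω y * (3 * (M * (1 + ‖y‖)) ^ 2) := mul_le_mul_of_nonneg_left (by linarith [hsq 0, hsq 1, hsq 2]) hω0
    _ = 3 * M ^ 2 * (ω y * (1 + ‖y‖) ^ 2) := by ring

/-- The same integrability, stated for the interpolant of the samples (`p1Field a h V`, `V = p1DispSite a h U b₀ A` — the form of parts 27–31). -/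
theorem integrable_p1Quad3_p1Field_p1DispSite {a h : ℝ} (ha : 0 < a) (hh : 0 < h) (W : (Fin 3 → ℝ) → Fin 3 → Fin 3 → ℝ)
    (hWc : ∀ k l, Continuous fun x => W x k l) (hW0 : ∀ y : Fin 3 → ℝ, ∀ u : Fin 3 → ℝ, 0 ≤ p1Quad3 (W y) u)
    {ω : (Fin 3 → ℝ) → ℝ} (hω : ∀ y : Fin 3 → ℝ, ∀ u : Fin 3 → ℝ, p1Quad3 (W y) u ≤ ω y * (u 0 ^ 2 + u 1 ^ 2 + u 2 ^ 2))
    (hωi : Integrable fun y => ω y * (1 + ‖y‖) ^ 2)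
    (U : ℤ × ℤ × ℤ → (Fin 3 → ℝ)) (hU : (support U).Finite) (b₀ : Fin 3 → ℝ) (A : Fin 3 → Fin 3 → ℝ) :
    Integrable fun y => p1Quad3 (W y) (p1Field a h (fun n k => p1DispSite a h U b₀ A n k) y) := by
  rw [← p1Disp_eq_p1Field ha.ne' hh.ne' U b₀ A]
  exact integrable_p1Quad3_p1Disp ha hh W hWc hW0 hω hωi U hU b₀ A

/-! ## The global bare-demand transfers for the far-ledger field, side conditions discharged -/

/-- **THE GLOBAL BARE-DEMAND TRANSFER, pointwise-majorant form, FOR THE FAR-LEDGER FIELD** (part 29 with `hint`, `hdef` discharged): for a continuous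
`W ⪰ 0` with a continuous pointwise majorant `ω`, `ω(1+‖y‖)²` integrable, and `V = p1DispSite a h U b₀ A` (`U` finitely supported),
`Σ'_q p1SiteBare q ≤ ∫ q_W(p1Disp) + ¼·Σ'_T (∫_T ω)·EdgeEnergy_T`.  NOT a proof of H12⋆, NOT summit progress. -/
theorem tsum_p1SiteBare_le_fun_p1DispSite {a h : ℝ} (ha : 0 < a) (hh : 0 < h) (W : (Fin 3 → ℝ) → Fin 3 → Fin 3 → ℝ)
    (hWc : ∀ k l, Continuous fun x => W x k l) (hW0 : ∀ y : Fin 3 → ℝ, ∀ u : Fin 3 → ℝ, 0 ≤ p1Quad3 (W y) u)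
    {ω : (Fin 3 → ℝ) → ℝ} (hωc : Continuous ω)
    (hω : ∀ y : Fin 3 → ℝ, ∀ u : Fin 3 → ℝ, p1Quad3 (W y) u ≤ ω y * (u 0 ^ 2 + u 1 ^ 2 + u 2 ^ 2))
    (hωi : Integrable fun y => ω y * (1 + ‖y‖) ^ 2)
    (U : ℤ × ℤ × ℤ → (Fin 3 → ℝ)) (hU : (support U).Finite) (b₀ : Fin 3 → ℝ) (A : Fin 3 → Fin 3 → ℝ) :
    Summable (p1SiteBare a h W (fun n k => p1DispSite a h U b₀ A n k)) ∧
    ∑' q, p1SiteBare a h W (fun n k => p1DispSite a h U b₀ A n k) q ≤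
      (∫ y, p1Quad3 (W y) (p1Disp a h U b₀ A y)) +
        1 / 4 * ∑' i, (∫ y in p1RealCell a h i, ω y) * p1CellEdgeEnergy (fun n k => p1DispSite a h U b₀ A n k) i := by
  have hω0 : ∀ y, 0 ≤ ω y := fun y => p1Quad3_majorant_nonneg (hW0 y) (hω y)
  have hωi' : Integrable ω := by
    refine Integrable.mono' hωi hωc.aestronglyMeasurable (Eventually.of_forall fun y => ?_)
    rw [Real.norm_eq_abs, abs_of_nonneg (hω0 y)]
    have : (1 : ℝ) ≤ (1 + ‖y‖) ^ 2 := by nlinarith [norm_nonneg y]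
    nlinarith [hω0 y]
  have hint := integrable_p1Quad3_p1Field_p1DispSite ha hh W hWc hW0 hω hωi U hU b₀ A
  have hdef := summable_edgeDefect_p1DispSite ha hh U hU b₀ A hω0 hωi'
  have hmain := tsum_p1SiteBare_le_fun ha hh W hWc hW0 hωc hω _ hint hdef
  rw [← p1Disp_eq_p1Field ha.ne' hh.ne' U b₀ A] at hmain
  exact hmain

/-- **THE GLOBAL BARE-DEMAND TRANSFER, circumradius form, FOR THE FAR-LEDGER FIELD** (part 31 with `hint`, `hdef` discharged): for a continuous
`W ⪰ 0` with a continuous pointwise majorant `ω`, `ω(1+‖y‖)²` integrable, cell centres `c_T` with squared vertex distances `≤ ρ_T`, `|ρ_T| ≤ ρ₀`, and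
`V = p1DispSite a h U b₀ A` (`U` finitely supported),
`Σ'_q p1SiteBare q ≤ ∫ q_W(p1Disp) + Σ'_T (∫_T ω)·ρ_T·|G_T(U) − A|²_F`.  NOT a proof of H12⋆, NOT summit progress. -/
theorem tsum_p1SiteBare_le_rad_p1DispSite {a h : ℝ} (ha : 0 < a) (hh : 0 < h) (W : (Fin 3 → ℝ) → Fin 3 → Fin 3 → ℝ)
    (hWc : ∀ k l, Continuous fun x => W x k l) (hW0 : ∀ y : Fin 3 → ℝ, ∀ u : Fin 3 → ℝ, 0 ≤ p1Quad3 (W y) u)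
    {ω : (Fin 3 → ℝ) → ℝ} (hωc : Continuous ω)
    (hω : ∀ y : Fin 3 → ℝ, ∀ u : Fin 3 → ℝ, p1Quad3 (W y) u ≤ ω y * (u 0 ^ 2 + u 1 ^ 2 + u 2 ^ 2))
    (hωi : Integrable fun y => ω y * (1 + ‖y‖) ^ 2)
    (U : ℤ × ℤ × ℤ → (Fin 3 → ℝ)) (hU : (support U).Finite) (b₀ : Fin 3 → ℝ) (A : Fin 3 → Fin 3 → ℝ)
    (c : (ℤ × ℤ × ℤ) × Fin 6 → Fin 3 → ℝ) (ρ : (ℤ × ℤ × ℤ) × Fin 6 → ℝ)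
    (hρ : ∀ i, ∀ m : Fin 4, fpSq (fun k => hcpSite a h (i.1 + p1VertOff (p1Par i.1) i.2 m) k - c i k) ≤ ρ i)
    {ρ₀ : ℝ} (hρ₀ : ∀ i, |ρ i| ≤ ρ₀) :
    Summable (p1SiteBare a h W (fun n k => p1DispSite a h U b₀ A n k)) ∧
    ∑' q, p1SiteBare a h W (fun n k => p1DispSite a h U b₀ A n k) q ≤
      (∫ y, p1Quad3 (W y) (p1Disp a h U b₀ A y)) +
        ∑' i, (∫ y in p1RealCell a h i, ω y) * (ρ i * fpFrob (fun j k => p1CellGrad a h U i j k - A j k)) := by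
  have hω0 : ∀ y, 0 ≤ ω y := fun y => p1Quad3_majorant_nonneg (hW0 y) (hω y)
  have hωi' : Integrable ω := by
    refine Integrable.mono' hωi hωc.aestronglyMeasurable (Eventually.of_forall fun y => ?_)
    rw [Real.norm_eq_abs, abs_of_nonneg (hω0 y)]
    have : (1 : ℝ) ≤ (1 + ‖y‖) ^ 2 := by nlinarith [norm_nonneg y]
    nlinarith [hω0 y]
  have hint := integrable_p1Quad3_p1Field_p1DispSite ha hh W hWc hW0 hω hωi U hU b₀ A
  have hdef := summable_radDefect_p1DispSite ha hh U hU b₀ A hω0 hωi' ρ hρ₀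
  have hmain := tsum_p1SiteBare_le_rad ha hh W hWc hW0 hωc hω _ hint c ρ hρ hdef
  rw [← p1Disp_eq_p1Field ha.ne' hh.ne' U b₀ A] at hmain
  simp only [p1CellGrad_p1DispSite ha hh] at hmain
  exact hmain

end Summit.AtomisticToContinuum.Crystallization.Theorems.StrictSplittingRuleBirth

end
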